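import Summits.BirchSwinnertonDyer.Uniform.UI.O2Binder
import HarnessLib

/-!
# Uniform/UI/O2 — the O2 mechanism at EVERY multiplicative prime: «`Σ²_E(P) ∉ ℚ·μ(ℚ_p)`» gives
# Schneider's binder `RegulatorNonvanishingAt W p` (non-split, rank one), by `ker log_p = p^ℤ·μ(ℚ_p)`

HONEST FRAMING (cell `bsd-uniform`, seat `ui-o2`, gen 6; verbatim rule of the cell): nothing here
proves anything about BSD, about the conjecture `TateSigmaIrrationalAtThree` (C4), or converts any
class. This file RECORDS, as kernel theorems with the Diophantine property as an INLINE HYPOTHESIS,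
what the gen-2 binder theorem K0 (`O2Binder.lean`, `p = 3`) becomes at an arbitrary prime `p`: the
mechanism "`ĥ_p(P) = log_p(den x) − log_p Σ²_E(P)` (`heightFourOneCoord_eq`, `rfl`) and
`ker(log_p : ℚ_pˣ → ℚ_p) = p^ℤ·μ(ℚ_p)` (tree fact `padicLog_eq_zero_iff_holds`, Iwasawa 1972 §4.4)"
needs only that `Σ²_E(P)` is NOT of the form `r·ζ` with `r ∈ ℚ` and `ζ` a root of unity of `ℚ_p`.
At `p = 3` (`μ(ℚ₃) = {±1} ⊂ ℚ`, gen 2's `eq_one_or_eq_neg_one_of_pow_eq_one_padicThree`) that is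
literally C4 (`ne_ratCast_mul_rootOfUnity_of_tateSigmaIrrational`), so gen 2's
`regulatorNonvanishingAt_three_of_tateSigmaIrrational` is the `p = 3` instance of
`regulatorNonvanishingAt_of_ne_ratCast_mul_rootOfUnity` below; at `p ≥ 5` the Teichmüller units
`μ_{p−1} ⊄ ℚ` enter, as the write-up anticipated (`O2-CONJECTURE.md` §7 (b): "at `p ≥ 5` … the
analogue would read «`Σ² ∉ ℚ·μ_{p−1}`»"). NO conjecture is filed at `p ≠ 3` by this seat (pocket O2
is `p = 3`; the `p ≥ 5` classes X11b are the census's pocket N8, owned elsewhere; cell decision D7: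
no widening): the hypothesis stays inline, per curve, and the theorems are a hand-over record for
whoever formulates N8's non-split lever input. The per-curve form also drops `Mult W p` — the
implication is pure `log_p` algebra on SW's formula (4.1) for ANY `W`, `q` and any datum `Dh` pinned by
`IsMultCanonical Dh q`; multiplicativity only matters for such a datum to be THE height.

Contents (namespace `Summit.BirchSwinnertonDyer.Uniform.UI.O2`; theorems only, no `def`, no named
fact, no `sorry`): `heightFourOneCoord_ne_zero_of_ne_ratCast_mul_rootOfUnity` (point level) ·
`pairing_self_ne_zero_of_admissible_of_ne_ratCast_mul_rootOfUnity` ·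
`pairing_self_ne_zero_of_ne_ratCast_mul_rootOfUnity` (anisotropy on `E(ℚ)/tors`) ·
`schneider_of_ne_ratCast_mul_rootOfUnity_of_rank_one` (`Reg_p ≠ 0` in Mordell–Weil rank one) ·
`regulatorNonvanishingAt_of_ne_ratCast_mul_rootOfUnity` (the lever's per-pair input
`X11b.ClassClosure.RegulatorNonvanishingAt W p` at a NON-split `p`, any prime) ·
`ne_ratCast_mul_rootOfUnity_of_tateSigmaIrrational` (at `p = 3`, C4 ⟹ the hypothesis).
Consumer of the conclusion at any `p`: `X11b.ClassClosure.bsdp_of_leverLocus_of_regulatorNonvanishing`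
(Skinner 2016 Thm. A + SW 2013 Thm. 6.1 + Disegni 2020 Thm. 1; on `LeverLocusAt W p` the split case
needs `p ≥ 5` and the SPLIT conjunct of the binder, which this mechanism does not touch —
`heightSplitCoord` carries `−log_p(u)²/log_p q_E`).

References: [SteinWuthrich2013] §4.1 (4.1), §4.2; [Iwasawa1972PadicL] §4.4; [Schneider1982PadicHeightI]
§1; [MazurSteinTate2006] Conj. 1.1; `HOME/ui/O2-CONJECTURE.md` §4 (K0), §7 (b), §11 (gen-6 record).
-/

noncomputable section

open scoped Classical
open WeierstrassCurve Literature.NumberTheory.EllipticCurves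
open Literature.NumberTheory.EllipticCurves.SteinWuthrich2013
open Literature.NumberTheory.EllipticCurves.Rank1Residual
open Summit.BirchSwinnertonDyer.Rank1Residual.X11b.ClassClosure

namespace Summit.BirchSwinnertonDyer.Uniform.UI.O2

variable {p : ℕ} [hp : Fact p.Prime]

/-- **Point level, any prime `p`, any `W`, `q`.** If `Σ²_W(P)` (SW §4.2 coordinates at `q`,
`tateSigmaValueSq W p q x y`) is not a rational multiple of a root of unity of `ℚ_p`, then SW's height
(4.1) `log_p(den x) − log_p Σ²` is non-zero: otherwise `c = Σ²/den x` has `log_p c = 0`, so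
`(c·p^{−n})^k = 1` for some `n ∈ ℤ`, `k > 0` (`padicLog_eq_zero_iff_holds`), i.e.
`Σ² = (den x · p^n)·ζ` with `ζ = c·p^{−n}` a root of unity. [cite: Iwasawa1972PadicL, §4.4]
[cite: SteinWuthrich2013, §4.1 eq. (4.1), §4.2] -/
theorem heightFourOneCoord_ne_zero_of_ne_ratCast_mul_rootOfUnity (W : WeierstrassCurve ℚ)
    {q : ℚ_[p]} {x y : ℚ}
    (hsig : ∀ (r : ℚ) (ζ : ℚ_[p]) (k : ℕ), 0 < k → ζ ^ k = 1 →
      tateSigmaValueSq W p q x y ≠ (r : ℚ_[p]) * ζ) :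
    heightFourOneCoord W p q x y ≠ 0 := by
  rw [heightFourOneCoord_eq]
  intro hzero
  set b : ℚ_[p] := tateSigmaValueSq W p q x y with hb_def
  have hb : b ≠ 0 := fun h0 =>
    hsig 0 1 1 one_pos (one_pow 1) (by rw [h0, Rat.cast_zero, zero_mul])
  have hd : ((x.den : ℚ) : ℚ_[p]) ≠ 0 := by exact_mod_cast x.den_nz
  have hlog : padicLog p b = padicLog p ((x.den : ℚ) : ℚ_[p]) := (sub_eq_zero.mp hzero).symm
  set c : ℚ_[p] := b * ((x.den : ℚ) : ℚ_[p])⁻¹ with hc_def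
  have hc0 : c ≠ 0 := mul_ne_zero hb (inv_ne_zero hd)
  have hinv : padicLog p (((x.den : ℚ) : ℚ_[p])⁻¹) = -padicLog p ((x.den : ℚ) : ℚ_[p]) := by
    have h := padicLog_mul_holds p (x := ((x.den : ℚ) : ℚ_[p])) (y := ((x.den : ℚ) : ℚ_[p])⁻¹) hd
      (inv_ne_zero hd)
    rw [mul_inv_cancel₀ hd, padicLog_one p] at h
    linear_combination -h
  have hlogc : padicLog p c = 0 := by
    rw [hc_def, padicLog_mul_holds p hb (inv_ne_zero hd), hinv, hlog, add_neg_cancel]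
  obtain ⟨n, k, hk, hpow⟩ := (padicLog_eq_zero_iff_holds p hc0).mp hlogc
  have hp0 : ((p : ℕ) : ℚ_[p]) ≠ 0 := by exact_mod_cast hp.out.ne_zero
  have key : ((x.den : ℚ) : ℚ_[p]) * ((p : ℕ) : ℚ_[p]) ^ n * (c * ((p : ℕ) : ℚ_[p]) ^ (-n)) = b := by
    rw [hc_def]
    calc ((x.den : ℚ) : ℚ_[p]) * ((p : ℕ) : ℚ_[p]) ^ n *
          (b * ((x.den : ℚ) : ℚ_[p])⁻¹ * ((p : ℕ) : ℚ_[p]) ^ (-n))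
        = b * (((x.den : ℚ) : ℚ_[p]) * ((x.den : ℚ) : ℚ_[p])⁻¹) *
          (((p : ℕ) : ℚ_[p]) ^ n * ((p : ℕ) : ℚ_[p]) ^ (-n)) := by ring
      _ = b := by
          rw [mul_inv_cancel₀ hd, ← zpow_add₀ hp0, add_neg_cancel, zpow_zero, mul_one, mul_one]
  refine hsig ((x.den : ℚ) * (p : ℚ) ^ n) (c * ((p : ℕ) : ℚ_[p]) ^ (-n)) k hk hpow ?_
  push_cast
  exact key.symm

/-- **Admissible points.** For a datum `Dh` pinned by `IsMultCanonical Dh q` (its quadratic form is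
SW's (4.1) on admissible points), the per-curve hypothesis «`Σ²_W(P) ∉ ℚ·μ(ℚ_p)` at every admissible
`P`» gives `⟨P, P⟩ ≠ 0` at every admissible `P`. [cite: SteinWuthrich2013, §4.2] -/
theorem pairing_self_ne_zero_of_admissible_of_ne_ratCast_mul_rootOfUnity (W : WeierstrassCurve ℚ)
    {q : ℚ_[p]} {Dh : PAdicHeightData W p} (hDh : IsMultCanonical Dh q)
    (hsig : ∀ (x y : ℚ) (h : W.toAffine.Nonsingular x y), W.IsAdmissible p (.some x y h) →
      ∀ (r : ℚ) (ζ : ℚ_[p]) (k : ℕ), 0 < k → ζ ^ k = 1 →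
        tateSigmaValueSq W p q x y ≠ (r : ℚ_[p]) * ζ)
    {P : W.toAffine.Point} (hadm : W.IsAdmissible p P) : Dh.pairing P P ≠ 0 := by
  rw [hDh P hadm]
  cases P with
  | zero => exact absurd IsOfFinAddOrder.zero hadm.1
  | some x y hns =>
    exact heightFourOneCoord_ne_zero_of_ne_ratCast_mul_rootOfUnity W (hsig x y hns hadm)

/-- **Anisotropy on `E(ℚ)/tors`.** Same hypothesis ⟹ `⟨P, P⟩ ≠ 0` for EVERY non-torsion
`P ∈ E(ℚ)` (`W` globally minimal: some multiple `mP`, `m ≥ 1`, is admissible —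
`exists_admissible_nsmul_holds` —, and `⟨mP, mP⟩ = m²⟨P, P⟩`). [cite: SteinWuthrich2013, §4.2]
[cite: MazurSteinTate2006, §1] -/
theorem pairing_self_ne_zero_of_ne_ratCast_mul_rootOfUnity (W : WeierstrassCurve ℚ) [W.IsElliptic]
    [W.IsGloballyMinimal] {q : ℚ_[p]} {Dh : PAdicHeightData W p} (hDh : IsMultCanonical Dh q)
    (hsig : ∀ (x y : ℚ) (h : W.toAffine.Nonsingular x y), W.IsAdmissible p (.some x y h) →
      ∀ (r : ℚ) (ζ : ℚ_[p]) (k : ℕ), 0 < k → ζ ^ k = 1 →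
        tateSigmaValueSq W p q x y ≠ (r : ℚ_[p]) * ζ)
    {P : W.toAffine.Point} (hP : ¬ IsOfFinAddOrder P) : Dh.pairing P P ≠ 0 := by
  obtain ⟨m, hm0, hadm⟩ := exists_admissible_nsmul_holds W p P hP
  have hmP := pairing_self_ne_zero_of_admissible_of_ne_ratCast_mul_rootOfUnity W hDh hsig hadm
  intro hzero
  apply hmP
  rw [map_nsmul, map_nsmul, AddMonoidHom.nsmul_apply, hzero, nsmul_zero, nsmul_zero]

/-- **Rank one: Schneider's non-degeneracy.** Same hypothesis, `rank_ℤ E(ℚ) = 1` ⟹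
`Reg_p(E, Dh) ≠ 0` (`SchneiderConjecture Dh`) — `Reg_p = ⟨P₀, P₀⟩` on a Mordell–Weil basis `{P₀}`.
[cite: Schneider1982PadicHeightI, §1] [cite: SteinWuthrich2013, §4.2, Conj. 4.1] -/
theorem schneider_of_ne_ratCast_mul_rootOfUnity_of_rank_one (W : WeierstrassCurve ℚ) [W.IsElliptic]
    [W.IsGloballyMinimal] (hr : W.mordellWeilRank = 1) {q : ℚ_[p]} {Dh : PAdicHeightData W p}
    (hDh : IsMultCanonical Dh q)
    (hsig : ∀ (x y : ℚ) (h : W.toAffine.Nonsingular x y), W.IsAdmissible p (.some x y h) →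
      ∀ (r : ℚ) (ζ : ℚ_[p]) (k : ℕ), 0 < k → ζ ^ k = 1 →
        tateSigmaValueSq W p q x y ≠ (r : ℚ_[p]) * ζ) :
    SchneiderConjecture Dh := by
  -- adapted from `schneider_of_tateSigmaIrrational_of_rank_one` (gen 2, `O2Binder.lean`)
  obtain ⟨B, hB⟩ := W.exists_isMordellWeilBasis_holds
  have hcard : Fintype.card (Fin W.mordellWeilRank) = 1 := by rw [Fintype.card_fin, hr]
  let k : Fin W.mordellWeilRank := ⟨0, by omega⟩
  have hRegp : padicRegulator Dh = Dh.pairing (B k) (B k) := by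
    rw [← padicRegulatorOf_eq_padicRegulator_holds Dh hB, padicRegulatorOf]
    convert Matrix.det_eq_elem_of_card_eq_one (A := Dh.pairingMatrix B) hcard k
    rfl
  have hBk : ¬ IsOfFinAddOrder (B k) := by
    intro htor
    apply hB.1.ne_zero k
    letI : DecidableEq ℚ := fun a b ↦ Classical.propDecidable (a = b)
    simp only [Function.comp_apply]
    exact (QuotientAddGroup.eq_zero_iff _).mpr ((AddCommGroup.mem_torsion _).mpr (by convert htor))
  unfold SchneiderConjecture
  rw [hRegp]
  exact pairing_self_ne_zero_of_ne_ratCast_mul_rootOfUnity W hDh hsig hBk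

/-- **The lever's per-pair input at ANY non-split multiplicative prime, from the `p`-analogue of C4
on the curve.** For `W/ℚ` globally minimal, NOT split multiplicative at `p`, of Mordell–Weil rank one:
if for every `q` with `q ≠ 0`, `‖q‖ < 1`, `j(q) = j(W)` (the Tate parameter, if any — there is one iff
`‖j(W)‖_p > 1`) and every admissible `P = (x, y)`, `Σ²_W(P)` is not a rational multiple of a root of
unity of `ℚ_p`, then `RegulatorNonvanishingAt W p` (the split conjunct being vacuous). At `p = 3` the
hypothesis is C4 on the curve (`ne_ratCast_mul_rootOfUnity_of_tateSigmaIrrational`) and this is gen 2's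
`regulatorNonvanishingAt_three_of_tateSigmaIrrational`; at `p ≥ 5` it is the shape a uniform statement
for the NON-split cells of pocket N8 would take (record only; no conjecture filed here).
[cite: Schneider1982PadicHeightI, §1] [cite: SteinWuthrich2013, §4.2, Conj. 4.1] -/
theorem regulatorNonvanishingAt_of_ne_ratCast_mul_rootOfUnity (W : WeierstrassCurve ℚ)
    [W.IsElliptic] [W.IsGloballyMinimal] (hns : ¬ W.HasSplitMultiplicativeReductionAtPrime p)
    (hr : W.mordellWeilRank = 1)
    (hsig : ∀ (q : ℚ_[p]), q ≠ 0 → ‖q‖ < 1 → tateJ q = (W.j : ℚ_[p]) →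
      ∀ (x y : ℚ) (h : W.toAffine.Nonsingular x y), W.IsAdmissible p (.some x y h) →
      ∀ (r : ℚ) (ζ : ℚ_[p]) (k : ℕ), 0 < k → ζ ^ k = 1 →
        tateSigmaValueSq W p q x y ≠ (r : ℚ_[p]) * ζ) :
    RegulatorNonvanishingAt W p := by
  refine ⟨fun q Dh hq0 hq1 hj hDh ↦ ?_, fun Dq _ _ ↦ absurd Dq.split hns⟩
  exact schneider_of_ne_ratCast_mul_rootOfUnity_of_rank_one W hr hDh (hsig q hq0 hq1 hj)

/-- **At `p = 3` the hypothesis IS the conjecture C4 on the curve:** `μ(ℚ₃) = {±1}`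
(`eq_one_or_eq_neg_one_of_pow_eq_one_padicThree`), so `r·ζ = ±r ∈ ℚ` and `TateSigmaIrrationalAtThree`
excludes it; feeding this into `regulatorNonvanishingAt_of_ne_ratCast_mul_rootOfUnity` returns gen 2's
`regulatorNonvanishingAt_three_of_tateSigmaIrrational` (statement of record; not restated here).
[cite: Serre1973, Ch. II §3.1 Prop. 7] [cite: SteinWuthrich2013, §4.2] -/
theorem ne_ratCast_mul_rootOfUnity_of_tateSigmaIrrational (hC : TateSigmaIrrationalAtThree)
    (W : WeierstrassCurve ℚ) [W.IsElliptic] [W.IsGloballyMinimal] (hW : Mult W 3)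
    {q : ℚ_[3]} (hq0 : q ≠ 0) (hq : ‖q‖ < 1) (hj : tateJ q = (W.j : ℚ_[3]))
    {x y : ℚ} (h : W.toAffine.Nonsingular x y) (hP : W.IsAdmissible 3 (.some x y h))
    (r : ℚ) (ζ : ℚ_[3]) (k : ℕ) (hk : 0 < k) (hζ : ζ ^ k = 1) :
    tateSigmaValueSq W 3 q x y ≠ (r : ℚ_[3]) * ζ := by
  have hC' := hC
  unfold TateSigmaIrrationalAtThree at hC'
  rcases eq_one_or_eq_neg_one_of_pow_eq_one_padicThree hk hζ with h1 | h1
  · rw [h1, mul_one]; exact hC' W hW q hq0 hq hj x y h hP r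
  · rw [h1, mul_neg_one, ← Rat.cast_neg]; exact hC' W hW q hq0 hq hj x y h hP (-r)

end Summit.BirchSwinnertonDyer.Uniform.UI.O2

end
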